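import Literature.Probability.Percolation.KSTPeriodicTopology
import HarnessLib

/-!
# KST-type RSW for periodic measures: planar topology of lattice walks, II

Topic `Literature/Probability/Percolation`. Continuation of `KSTPeriodicTopology.lean`: with the
straight runs, hooks and the reduction lemma `meet_of_extensions` of that file, the remaining four
folklore planar-topology statements of `KSTPeriodicStatements.lean` are reduced to
`exists_mem_support_of_crossing` (a left–right and a top–bottom crossing walk of a rectangle meet;
Kesten 1982, §2.2):

* `alternatingTBMeet : AlternatingTBMeet` (two top–bottom walks with interleaved endpoints meet;
  the first orientation `alternatingTBMeet_of_lt`, the second by exchanging the walks);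
* `partsMeetMPath : PartsMeetMPath` (a bridge meets every `m`-path — the planar input of
  [KohlerSchindlerTassion2023, Lemma 5]);
* `partsToSegmentsMeet : PartsToSegmentsMeet` (crossed connections to the bottom segments meet —
  Lemma 1 there);
* `archesMeet : ArchesMeet` (interleaved arches above a row meet — the gluing of Fig. 6 there),
  after boxing the two finite walks (`exists_coord_bounds`).

In each case the two walks are extended outside their box by runs one or two layers away from the
boundary, to a left–right and a top–bottom crossing of the enlarged box; the runs meet the old box
only at the endpoints they hang on and are disjoint outside it (in `PartsMeetMPath` a clash forces
two endpoints to coincide), so a common vertex of the extensions is one of the original walks.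
All side conditions are linear arithmetic in the two coordinates (`omega`).

## References

* H. Kesten, *Percolation theory for mathematicians*, Birkhäuser (1982), §2.2.
* [KohlerSchindlerTassion2023] L. Köhler-Schindler, V. Tassion, *Crossing probabilities for planar
  percolation*, Duke Math. J. 172 (2023) 809–838, §3–§5.
-/

namespace Literature.Probability.Percolation

open SimpleGraph LatticeModels

noncomputable section

namespace KSTPeriodic

/-! ### Top–bottom walks with interleaved endpoints -/

/-- `AlternatingTBMeet`, first orientation: `σ` starts left of `γ` on the top row and ends right
of it on the bottom row. Extend `σ` to a left–right crossing of `[L-1, R+1] × [B-1, T+1]` by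
`(L-1, T+1) → (s₀, T+1) → s` and `f → (f₀, B-1) → (R+1, B-1)`, and `γ` to a top–bottom one by
one vertical step at each end. [folklore] -/
theorem alternatingTBMeet_of_lt {L R B T : ℤ} {g₁ g₂ s f : Site 2} (γ : (zdGraph 2).Walk g₁ g₂)
    (σ : (zdGraph 2).Walk s f) (hBT : B < T)
    (hγ : ∀ z ∈ γ.support, L ≤ z 0 ∧ z 0 ≤ R ∧ B ≤ z 1 ∧ z 1 ≤ T)
    (hσ : ∀ z ∈ σ.support, L ≤ z 0 ∧ z 0 ≤ R ∧ B ≤ z 1 ∧ z 1 ≤ T)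
    (hg₁ : g₁ 1 = T) (hg₂ : g₂ 1 = B) (hs : s 1 = T) (hf : f 1 = B) (h₁ : s 0 < g₁ 0)
    (h₂ : g₂ 0 < f 0) : ∃ z ∈ γ.support, z ∈ σ.support := by
  obtain ⟨u', C, hu'0, hu'1, hC⟩ := exists_hookWalk_vh (g₁ 0) (T + 1) g₁
  obtain ⟨v', D, hv'0, hv'1, hD⟩ := exists_hookWalk_from_vh g₂ (g₂ 0) (B - 1)
  obtain ⟨s', A, hs'0, hs'1, hA⟩ := exists_hookWalk_hv (L - 1) (T + 1) s
  obtain ⟨f', E, hf'0, hf'1, hE⟩ := exists_hookWalk_from_vh f (R + 1) (B - 1)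
  have hg₁b := hγ g₁ γ.start_mem_support
  have hg₂b := hγ g₂ γ.end_mem_support
  have hsb := hσ s σ.start_mem_support
  have hfb := hσ f σ.end_mem_support
  suffices key : ∃ z ∈ σ.support, z ∈ γ.support by
    obtain ⟨z, hzσ, hzγ⟩ := key; exact ⟨z, hzγ, hzσ⟩
  refine meet_of_extensions (L' := L - 1) (R' := R + 1) (B' := B - 1)
    (T' := T + 1) σ γ (A.append (σ.append E)) (C.append (γ.append D))
    (fun z => z ∈ A.support ∨ z ∈ E.support) (fun z => z ∈ C.support ∨ z ∈ D.support)
    hσ hγ (by omega) (fun z hz => mem_support_append3 hz) (fun z hz => mem_support_append3 hz)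
    ?_ ?_ ?_ ?_ ?_ (Or.inl ⟨by omega, by omega⟩) (Or.inl ⟨by omega, by omega⟩)
  · rintro z (hz | hz)
    · have := hA z hz; omega
    · have := hE z hz; omega
  · rintro z (hz | hz)
    · have := hC z hz; omega
    · have := hD z hz; omega
  · rintro z (hz | hz) hb
    · have := hA z hz
      exact mem_support_of_eq_start σ (by omega) (by omega)
    · have := hE z hz
      exact mem_support_of_eq_end σ (by omega) (by omega)
  · rintro z (hz | hz) hb
    · have := hC z hz
      exact mem_support_of_eq_start γ (by omega) (by omega)
    · have := hD z hz
      exact mem_support_of_eq_end γ (by omega) (by omega)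
  · rintro z (hz | hz) (hz' | hz') hb <;> exfalso
    · have := hA z hz; have := hC z hz'; omega
    · have := hA z hz; have := hD z hz'; omega
    · have := hE z hz; have := hC z hz'; omega
    · have := hE z hz; have := hD z hz'; omega

/-- **Top–bottom walks with interleaved endpoints meet** (`AlternatingTBMeet`): both orientations,
the second by exchanging the roles of the two walks. [folklore] -/
theorem alternatingTBMeet : AlternatingTBMeet := by
  intro L R B T g₁ g₂ s f γ σ hBT hγ hσ hg₁ hg₂ hs hf halt
  rcases halt with ⟨h₁, h₂⟩ | ⟨h₁, h₂⟩
  · exact alternatingTBMeet_of_lt γ σ hBT hγ hσ hg₁ hg₂ hs hf h₁ h₂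
  · obtain ⟨z, hzσ, hzγ⟩ := alternatingTBMeet_of_lt σ γ hBT hσ hγ hs hf hg₁ hg₂ h₁ h₂
    exact ⟨z, hzγ, hzσ⟩

/-! ### Bridges, m-paths and bottom segments -/

/-- **A bridge meets every m-path** (`PartsMeetMPath`). The m-path `Q` is extended by one vertical
step at each end to a top–bottom crossing of `[L-1, R+1] × [B-1, T+1]`; the bridge `P` is
extended at `p` by the step from `(L-1, p₁)` (if `p` is on the left column) or by the hook from
`(L-1, T+1)` along the row `T+1` (if `p` is on the top row with `p₀ ≤ xl`) or along the row `B-1`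
(bottom row), and symmetrically at `q`. A clash of the extensions outside the box forces `p` or `q`
to coincide with an endpoint of `Q`. [folklore] -/
theorem partsMeetMPath : PartsMeetMPath := by
  intro L R B T xl xr p q u v P Q hL hx hR hBT hP hQ hp hq hu hu₁ hu₂ hv hv₁ hv₂
  have hpb := hP p P.start_mem_support
  have hqb := hP q P.end_mem_support
  have hub := hQ u Q.start_mem_support
  have hvb := hQ v Q.end_mem_support
  obtain ⟨u', C, hu'0, hu'1, hC⟩ := exists_hookWalk_vh (u 0) (T + 1) u
  obtain ⟨v', D, hv'0, hv'1, hD⟩ := exists_hookWalk_from_vh v (v 0) (B - 1)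
  -- the extension at `p`
  obtain ⟨p', A, hp'0, hA⟩ : ∃ (p' : Site 2) (A : (zdGraph 2).Walk p' p), p' 0 = L - 1 ∧
      ∀ z ∈ A.support, (z 0 = p 0 ∧ z 1 = p 1) ∨ (p 0 = L ∧ z 0 = L - 1 ∧ z 1 = p 1) ∨
        (p 1 = T ∧ p 0 ≤ xl ∧ z 1 = T + 1 ∧ L - 1 ≤ z 0 ∧ z 0 ≤ p 0) ∨
        (p 1 = B ∧ p 0 ≤ xl ∧ z 1 = B - 1 ∧ L - 1 ≤ z 0 ∧ z 0 ≤ p 0) := by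
    rcases hp with hp0 | ⟨hpT | hpB, hpx⟩
    · obtain ⟨p', A, h0, -, hA⟩ := exists_hookWalk_hv (L - 1) (p 1) p
      exact ⟨p', A, h0, fun z hz => by have := hA z hz; omega⟩
    · obtain ⟨p', A, h0, -, hA⟩ := exists_hookWalk_hv (L - 1) (T + 1) p
      exact ⟨p', A, h0, fun z hz => by have := hA z hz; omega⟩
    · obtain ⟨p', A, h0, -, hA⟩ := exists_hookWalk_hv (L - 1) (B - 1) p
      exact ⟨p', A, h0, fun z hz => by have := hA z hz; omega⟩
  -- the extension at `q`
  obtain ⟨q', E, hq'0, hE⟩ : ∃ (q' : Site 2) (E : (zdGraph 2).Walk q q'), q' 0 = R + 1 ∧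
      ∀ z ∈ E.support, (z 0 = q 0 ∧ z 1 = q 1) ∨ (q 0 = R ∧ z 0 = R + 1 ∧ z 1 = q 1) ∨
        (q 1 = T ∧ xr ≤ q 0 ∧ z 1 = T + 1 ∧ q 0 ≤ z 0 ∧ z 0 ≤ R + 1) ∨
        (q 1 = B ∧ xr ≤ q 0 ∧ z 1 = B - 1 ∧ q 0 ≤ z 0 ∧ z 0 ≤ R + 1) := by
    rcases hq with hq0 | ⟨hqT | hqB, hqx⟩
    · obtain ⟨q', E, h0, -, hE⟩ := exists_hookWalk_from_vh q (R + 1) (q 1)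
      exact ⟨q', E, h0, fun z hz => by have := hE z hz; omega⟩
    · obtain ⟨q', E, h0, -, hE⟩ := exists_hookWalk_from_vh q (R + 1) (T + 1)
      exact ⟨q', E, h0, fun z hz => by have := hE z hz; omega⟩
    · obtain ⟨q', E, h0, -, hE⟩ := exists_hookWalk_from_vh q (R + 1) (B - 1)
      exact ⟨q', E, h0, fun z hz => by have := hE z hz; omega⟩
  refine meet_of_extensions (L' := L - 1) (R' := R + 1) (B' := B - 1)
    (T' := T + 1) P Q (A.append (P.append E)) (C.append (Q.append D))
    (fun z => z ∈ A.support ∨ z ∈ E.support) (fun z => z ∈ C.support ∨ z ∈ D.support)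
    hP hQ (by omega) (fun z hz => mem_support_append3 hz) (fun z hz => mem_support_append3 hz)
    ?_ ?_ ?_ ?_ ?_ (Or.inl ⟨by omega, by omega⟩) (Or.inl ⟨by omega, by omega⟩)
  · rintro z (hz | hz)
    · have := hA z hz; omega
    · have := hE z hz; omega
  · rintro z (hz | hz)
    · have := hC z hz; omega
    · have := hD z hz; omega
  · rintro z (hz | hz) hb
    · have := hA z hz
      exact mem_support_of_eq_start P (by omega) (by omega)
    · have := hE z hz
      exact mem_support_of_eq_end P (by omega) (by omega)
  · rintro z (hz | hz) hb
    · have := hC z hz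
      exact mem_support_of_eq_start Q (by omega) (by omega)
    · have := hD z hz
      exact mem_support_of_eq_end Q (by omega) (by omega)
  · -- a clash outside the box forces `p ∈ {u, v}` or `q ∈ {u, v}`
    rintro z (hz | hz) (hz' | hz') hb
    · have := hA z hz; have := hC z hz'
      exact ⟨p, P.start_mem_support, mem_support_of_eq_start Q (by omega) (by omega)⟩
    · have := hA z hz; have := hD z hz'
      exact ⟨p, P.start_mem_support, mem_support_of_eq_end Q (by omega) (by omega)⟩
    · have := hE z hz; have := hC z hz'
      exact ⟨q, P.end_mem_support, mem_support_of_eq_start Q (by omega) (by omega)⟩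
    · have := hE z hz; have := hD z hz'
      exact ⟨q, P.end_mem_support, mem_support_of_eq_end Q (by omega) (by omega)⟩

/-- **Crossed connections to the bottom segments meet** (`PartsToSegmentsMeet`). `P₁` is
extended to a left–right crossing of `[L-1, R+1] × [B-1, T+1]` (at `p₁`: the step from
`(L-1, p₁₁)` or the hook from `(L-1, T+1)` along the row `T+1`; at `b₁`: down to the row `B-1`
and right to `(R+1, B-1)`), `P₂` to a top–bottom crossing (at `p₂`: from `(R+1, T+1)` down the
column `R+1` and one step left, or one step up; at `b₂`: one step down). The extensions are
disjoint outside the box since `b₂₀ ≤ xl < xr ≤ b₁₀`. [folklore] -/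
theorem partsToSegmentsMeet : PartsToSegmentsMeet := by
  intro L R B T xl xr p₁ b₁ p₂ b₂ P₁ P₂ hL hx hR hBT hP₁ hP₂ hp₁ hb₁ hb₁x hp₂ hb₂ hb₂x
  have hp₁b := hP₁ p₁ P₁.start_mem_support
  have hb₁b := hP₁ b₁ P₁.end_mem_support
  have hp₂b := hP₂ p₂ P₂.start_mem_support
  have hb₂b := hP₂ b₂ P₂.end_mem_support
  -- the extension at `p₁`
  obtain ⟨p', A, hp'0, hA⟩ : ∃ (p' : Site 2) (A : (zdGraph 2).Walk p' p₁), p' 0 = L - 1 ∧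
      ∀ z ∈ A.support, (z 0 = p₁ 0 ∧ z 1 = p₁ 1) ∨ (p₁ 0 = L ∧ z 0 = L - 1 ∧ z 1 = p₁ 1) ∨
        (p₁ 1 = T ∧ p₁ 0 ≤ xl ∧ z 1 = T + 1 ∧ L - 1 ≤ z 0 ∧ z 0 ≤ p₁ 0) := by
    rcases hp₁ with hp0 | ⟨hpT, hpx⟩
    · obtain ⟨p', A, h0, -, hA⟩ := exists_hookWalk_hv (L - 1) (p₁ 1) p₁
      exact ⟨p', A, h0, fun z hz => by have := hA z hz; omega⟩
    · obtain ⟨p', A, h0, -, hA⟩ := exists_hookWalk_hv (L - 1) (T + 1) p₁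
      exact ⟨p', A, h0, fun z hz => by have := hA z hz; omega⟩
  obtain ⟨q', E, hq'0, hq'1, hE⟩ := exists_hookWalk_from_vh b₁ (R + 1) (B - 1)
  -- the extension at `p₂`
  obtain ⟨u', C, hu'1, hC⟩ : ∃ (u' : Site 2) (C : (zdGraph 2).Walk u' p₂), u' 1 = T + 1 ∧
      ∀ z ∈ C.support, (z 0 = p₂ 0 ∧ z 1 = p₂ 1) ∨
        (p₂ 0 = R ∧ z 0 = R + 1 ∧ p₂ 1 ≤ z 1 ∧ z 1 ≤ T + 1) ∨
        (p₂ 1 = T ∧ xr ≤ p₂ 0 ∧ z 0 = p₂ 0 ∧ z 1 = T + 1) := by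
    rcases hp₂ with hp0 | ⟨hpT, hpx⟩
    · obtain ⟨u', C, -, h1, hC⟩ := exists_hookWalk_vh (R + 1) (T + 1) p₂
      exact ⟨u', C, h1, fun z hz => by have := hC z hz; omega⟩
    · obtain ⟨u', C, -, h1, hC⟩ := exists_hookWalk_vh (p₂ 0) (T + 1) p₂
      exact ⟨u', C, h1, fun z hz => by have := hC z hz; omega⟩
  obtain ⟨v', D, hv'0, hv'1, hD⟩ := exists_hookWalk_from_vh b₂ (b₂ 0) (B - 1)
  refine meet_of_extensions (L' := L - 1) (R' := R + 1) (B' := B - 1)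
    (T' := T + 1) P₁ P₂ (A.append (P₁.append E)) (C.append (P₂.append D))
    (fun z => z ∈ A.support ∨ z ∈ E.support) (fun z => z ∈ C.support ∨ z ∈ D.support)
    hP₁ hP₂ (by omega) (fun z hz => mem_support_append3 hz) (fun z hz => mem_support_append3 hz)
    ?_ ?_ ?_ ?_ ?_ (Or.inl ⟨by omega, by omega⟩) (Or.inl ⟨by omega, by omega⟩)
  · rintro z (hz | hz)
    · have := hA z hz; omega
    · have := hE z hz; omega
  · rintro z (hz | hz)
    · have := hC z hz; omega
    · have := hD z hz; omega
  · rintro z (hz | hz) hb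
    · have := hA z hz
      exact mem_support_of_eq_start P₁ (by omega) (by omega)
    · have := hE z hz
      exact mem_support_of_eq_end P₁ (by omega) (by omega)
  · rintro z (hz | hz) hb
    · have := hC z hz
      exact mem_support_of_eq_start P₂ (by omega) (by omega)
    · have := hD z hz
      exact mem_support_of_eq_end P₂ (by omega) (by omega)
  · rintro z (hz | hz) (hz' | hz') hb <;> exfalso
    · have := hA z hz; have := hC z hz'; omega
    · have := hA z hz; have := hD z hz'; omega
    · have := hE z hz; have := hC z hz'; omega
    · have := hE z hz; have := hD z hz'; omega

/-! ### Interleaved arches -/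

/-- A finite list of lattice points is bounded: column bounds and a row bound. [folklore] -/
theorem exists_coord_bounds (l : List (Site 2)) : ∃ L R T : ℤ, ∀ z ∈ l, L ≤ z 0 ∧ z 0 ≤ R ∧ z 1 ≤ T := by
  induction l with
  | nil => exact ⟨0, 0, 0, fun z hz => by simp at hz⟩
  | cons w l ih =>
    obtain ⟨L, R, T, h⟩ := ih
    refine ⟨min L (w 0), max R (w 0), max T (w 1), fun z hz => ?_⟩
    rw [List.mem_cons] at hz
    rcases hz with rfl | hz
    · exact ⟨min_le_right _ _, le_max_right _ _, le_max_right _ _⟩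
    · obtain ⟨h₁, h₂, h₃⟩ := h z hz
      exact ⟨(min_le_left _ _).trans h₁, h₂.trans (le_max_left _ _), h₃.trans (le_max_left _ _)⟩

/-- **Interleaved arches meet** (`ArchesMeet`). Put both arches in a box `[L, R] × [lo, hi]`.
The arch `Q` from `a'` to `b'` is extended to a left–right crossing of
`[L-1, R+1] × [lo-2, hi+1]` along the row `lo-2` (hooks `(L-1, lo-2) → (a'₀, lo-2) → a'` and
`b' → (b'₀, lo-2) → (R+1, lo-2)`), the arch `P` from `a` to `b` to a top–bottom crossing (down the
column `L-1` from the row `hi+1` to the row `lo-1`, along it to `(a₀, lo-1)`, up to `a`; and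
`b → (b₀, lo-2)`). The interleaving `a₀ < a'₀ < b₀ < b'₀` makes the extensions disjoint.
[folklore] -/
theorem archesMeet : ArchesMeet := by
  intro lo a b a' b' P Q hP hQ ha hb ha' hb' h₁ h₂ h₃
  obtain ⟨L, R, hi, hbd⟩ := exists_coord_bounds (P.support ++ Q.support)
  have hPb : ∀ z ∈ P.support, L ≤ z 0 ∧ z 0 ≤ R ∧ lo ≤ z 1 ∧ z 1 ≤ hi := fun z hz => by
    have := hbd z (List.mem_append.2 (Or.inl hz)); have := hP z hz; omega
  have hQb : ∀ z ∈ Q.support, L ≤ z 0 ∧ z 0 ≤ R ∧ lo ≤ z 1 ∧ z 1 ≤ hi := fun z hz => by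
    have := hbd z (List.mem_append.2 (Or.inr hz)); have := hQ z hz; omega
  have hab := hPb a P.start_mem_support
  have hbb := hPb b P.end_mem_support
  have ha'b := hQb a' Q.start_mem_support
  have hb'b := hQb b' Q.end_mem_support
  -- `P` becomes the top–bottom crossing
  obtain ⟨c, C₂, hc0, hc1, hC₂⟩ := exists_hookWalk_vh (a 0) (lo - 1) a
  obtain ⟨u', C₁, hu'0, hu'1, hC₁⟩ := exists_hookWalk_vh (L - 1) (hi + 1) c
  obtain ⟨v', D, hv'0, hv'1, hD⟩ := exists_hookWalk_from_vh b (b 0) (lo - 2)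
  -- `Q` becomes the left–right crossing
  obtain ⟨p', A, hp'0, hp'1, hA⟩ := exists_hookWalk_hv (L - 1) (lo - 2) a'
  obtain ⟨q', E, hq'0, hq'1, hE⟩ := exists_hookWalk_from_vh b' (R + 1) (lo - 2)
  suffices key : ∃ z ∈ Q.support, z ∈ P.support by
    obtain ⟨z, hzQ, hzP⟩ := key; exact ⟨z, hzP, hzQ⟩
  refine meet_of_extensions (L' := L - 1) (R' := R + 1) (B' := lo - 2)
    (T' := hi + 1) Q P (A.append (Q.append E)) ((C₁.append C₂).append (P.append D))
    (fun z => z ∈ A.support ∨ z ∈ E.support)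
    (fun z => (z ∈ C₁.support ∨ z ∈ C₂.support) ∨ z ∈ D.support)
    hQb hPb (by omega) (fun z hz => mem_support_append3 hz)
    (fun z hz => by simpa only [Walk.mem_support_append_iff] using mem_support_append3 hz)
    ?_ ?_ ?_ ?_ ?_ (Or.inl ⟨by omega, by omega⟩) (Or.inl ⟨by omega, by omega⟩)
  · rintro z (hz | hz)
    · have := hA z hz; omega
    · have := hE z hz; omega
  · rintro z ((hz | hz) | hz)
    · have := hC₁ z hz; omega
    · have := hC₂ z hz; omega
    · have := hD z hz; omega
  · rintro z (hz | hz) hzb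
    · have := hA z hz
      exact mem_support_of_eq_start Q (by omega) (by omega)
    · have := hE z hz
      exact mem_support_of_eq_end Q (by omega) (by omega)
  · rintro z ((hz | hz) | hz) hzb
    · have := hC₁ z hz; exfalso; omega
    · have := hC₂ z hz
      exact mem_support_of_eq_start P (by omega) (by omega)
    · have := hD z hz
      exact mem_support_of_eq_end P (by omega) (by omega)
  · rintro z (hz | hz) ((hz' | hz') | hz') hzb <;> exfalso
    · have := hA z hz; have := hC₁ z hz'; omega
    · have := hA z hz; have := hC₂ z hz'; omega
    · have := hA z hz; have := hD z hz'; omega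
    · have := hE z hz; have := hC₁ z hz'; omega
    · have := hE z hz; have := hC₂ z hz'; omega
    · have := hE z hz; have := hD z hz'; omega

/-! ### Discharges under the census names

Added 2026-08-16 (append-only extension): the named facts `AlternatingTBMeet`, `PartsMeetMPath`,
`PartsToSegmentsMeet` and `ArchesMeet` of `KSTPeriodicStatements.lean` are discharged by the four
theorems above; the `_holds` aliases record this under the standard discharge names (as
`KSTPeriodicTopology.lean` does for `TopSideToLeftMeetsTB`, `TopSideToRightMeetsTB`). -/

/-- Discharge of the named fact `AlternatingTBMeet` (by `alternatingTBMeet`): two top–bottom walks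
of a box with interleaved endpoints meet. (Kesten 1982, §2.2; Bollobás–Riordan 2006, Ch. 3.)
[folklore] -/
theorem AlternatingTBMeet_holds : AlternatingTBMeet := alternatingTBMeet

/-- Discharge of the named fact `PartsMeetMPath` (by `partsMeetMPath`): in a box, a walk between
the left and right parts of the boundary meets every walk between the upper and lower targets —
the planar input of [KohlerSchindlerTassion2023, Lemma 5]. (Kesten 1982, §2.2; Bollobás–Riordan
2006, Ch. 3.) [folklore] -/
theorem PartsMeetMPath_holds : PartsMeetMPath := partsMeetMPath

/-- Discharge of the named fact `PartsToSegmentsMeet` (by `partsToSegmentsMeet`): crossed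
connections to the two bottom segments meet — the planar input of
[KohlerSchindlerTassion2023, Lemma 1]. (Kesten 1982, §2.2.) [folklore] -/
theorem PartsToSegmentsMeet_holds : PartsToSegmentsMeet := partsToSegmentsMeet

/-- Discharge of the named fact `ArchesMeet` (by `archesMeet`): interleaved arches above a row
meet. (Kesten 1982, §2.2.) [folklore] -/
theorem ArchesMeet_holds : ArchesMeet := archesMeet

end KSTPeriodic

end

end Literature.Probability.Percolation
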